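import Literature.MathematicalPhysics.QuantumFieldTheory.OSTemperedness
import Literature.MathematicalPhysics.QuantumLattice.SchwartzLocalDensity
import Literature.Analysis.Distribution.SchwartzBoundaryFlatness
import HarnessLib

/-!
# Osterwalder–Schrader II, Theorem 4.1: the global representation (4.4) and translation invariance

Topic `Literature/MathematicalPhysics/QuantumFieldTheory`; sequel of `OSTemperedness`
(Osterwalder–Schrader, *Axioms for Euclidean Green's functions II*, Comm. Math. Phys. 42 (1975),
Thm. 4.1). `OSPointwiseAnalyticity`/`OSTemperedness` produce the real-analytic density `S` of
`𝔖_{k+2}` on the ordered region `Ω = {x⁰_0 < ⋯ < x⁰_{k+1}}` with the temperedness estimate (4.5),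
but with the representation `𝔖_{k+2}(F) = ∫ S F` only for test functions supported in small balls.
This file upgrades it to OS's (4.4) as printed — *"for all `f ∈ 𝒮(ℝ₊^{4k})`"*, i.e. for **every**
test function supported in the (open) ordered region, compactly or not — and records the diagonal
translation invariance of the density:

* `infDist_compl_orderedRegion_le_gap`, `…_le_minGap` — every time gap of `x ∈ Ω` is at least
  `dist(x, Ωᶜ)` (collapse the gap), so the blow-up `(1 + (minGap x)⁻¹)ᴺ` of (4.5) is of the
  boundary-distance type handled by `SchwartzBoundaryFlatness`;
* `integrable_density_mul` — `S · F` is integrable for `tsupport F ⊆ Ω` (a Schwartz function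
  supported in `Ω` vanishes to infinite order at `∂Ω`);
* `schwinger_exists_density_global` — **Thm. 4.1 with (4.4) and (4.5)**: the density `S`
  (continuous, with local holomorphic charts, tempered) satisfies `𝔖_{k+2}(F) = ∫ S F` for all
  `F ∈ 𝓢` with `tsupport F ⊆ Ω` (`SchwartzLocalDensity.apply_eq_integral_of_localDensity`), and
  `S(x + a) = S(x)` for every diagonal translation `a` (E1 and the uniqueness of continuous
  densities).

## References

* K. Osterwalder, R. Schrader, *Axioms for Euclidean Green's functions II*, Comm. Math. Phys.
  42 (1975) 281–305, Thm. 4.1, (4.4)–(4.5). [OsterwalderSchraderCMP1975]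
-/

noncomputable section

open MeasureTheory Set Filter Metric
open _root_.Topology
open scoped SchwartzMap

namespace Literature.MathematicalPhysics.QuantumFieldTheory

open Literature.MathematicalPhysics.QuantumLattice (SchwingerFamily translateMulti translateMulti_apply
  apply_eq_integral_of_localDensity)
open Literature.MathematicalPhysics.QuantumLattice.SchwingerFamily
open Literature.Analysis.Distribution

variable {d : ℕ} [NeZero d] {k : ℕ}

/-! ### Gaps and the distance to the boundary of the ordered region -/

/-- **Collapsing a gap leaves the ordered region**: moving the point `i+1` back in time by the gap
`x⁰_{i+1} − x⁰_i` produces a configuration outside `Ω`, at distance the gap. Hence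
`dist(x, Ωᶜ) ≤ x⁰_{i+1} − x⁰_i`. [folklore] -/
theorem infDist_compl_orderedRegion_le_gap {x : Fin (k + 2) → EuclideanSpace ℝ (Fin d)}
    (hx : x ∈ orderedRegion k d) (i : Fin (k + 1)) :
    infDist x (orderedRegion k d)ᶜ ≤ x i.succ 0 - x (Fin.castSucc i) 0 := by
  set g : ℝ := x i.succ 0 - x (Fin.castSucc i) 0 with hg
  have hg0 : 0 ≤ g := (sub_pos.2 (hx i)).le
  set y : Fin (k + 2) → EuclideanSpace ℝ (Fin d) :=
    Function.update x i.succ (x i.succ - EuclideanSpace.single 0 g) with hy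
  have hyi : y i.succ 0 = x (Fin.castSucc i) 0 := by
    rw [hy, Function.update_self]
    simp [hg]
  have hyc : y (Fin.castSucc i) = x (Fin.castSucc i) := by
    rw [hy, Function.update_of_ne (Fin.castSucc_lt_succ (i := i)).ne]
  have hyU : y ∈ (orderedRegion k d)ᶜ := by
    intro h
    have h1 := h i
    rw [hyi, hyc] at h1
    exact lt_irrefl _ h1
  refine (infDist_le_dist_of_mem hyU).trans ?_
  refine (dist_pi_le_iff hg0).2 fun j => ?_
  by_cases hj : j = i.succ
  · subst hj
    rw [hy, Function.update_self, dist_eq_norm, sub_sub_cancel, PiLp.norm_single,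
      Real.norm_of_nonneg hg0]
  · rw [hy, Function.update_of_ne hj, dist_self]
    exact hg0

/-- `dist(x, Ωᶜ) ≤ minGap x` on the ordered region. [folklore] -/
theorem infDist_compl_orderedRegion_le_minGap {x : Fin (k + 2) → EuclideanSpace ℝ (Fin d)}
    (hx : x ∈ orderedRegion k d) : infDist x (orderedRegion k d)ᶜ ≤ minGap x :=
  (Finset.le_inf'_iff _ _).2 fun i _ => infDist_compl_orderedRegion_le_gap hx i

/-- The zero configuration is not ordered; the complement of the ordered region is nonempty. [folklore] -/
theorem compl_orderedRegion_nonempty : ((orderedRegion k d)ᶜ : Set (Fin (k + 2) → EuclideanSpace ℝ (Fin d))).Nonempty := by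
  refine ⟨0, fun h => ?_⟩
  have h0 : (0 : Fin (k + 2) → EuclideanSpace ℝ (Fin d)) (Fin.castSucc 0) 0 <
      (0 : Fin (k + 2) → EuclideanSpace ℝ (Fin d)) (0 : Fin (k + 1)).succ 0 := h 0
  simp at h0

/-! ### Integrability of `S · F` -/

/-- **The tempered density times a test function of the ordered region is integrable**: if `S` is
continuous on `Ω` with `‖S x‖ ≤ C (1 + ‖x‖)ᴺ (1 + (minGap x)⁻¹)ᴺ` there ((4.5)), then `S · F` is
integrable for every `F ∈ 𝓢` with `tsupport F ⊆ Ω`. [cite: OsterwalderSchraderCMP1975, Thm. 4.1 (4.4)–(4.5)] -/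
theorem integrable_density_mul {S : (Fin (k + 2) → EuclideanSpace ℝ (Fin d)) → ℂ}
    (hS : ContinuousOn S (orderedRegion k d)) {C : ℝ} {N : ℕ}
    (hb : ∀ x ∈ orderedRegion k d, ‖S x‖ ≤ C * (1 + ‖x‖) ^ N * (1 + (minGap x)⁻¹) ^ N)
    (F : 𝓢((Fin (k + 2) → EuclideanSpace ℝ (Fin d)), ℂ))
    (hF : tsupport (F : (Fin (k + 2) → EuclideanSpace ℝ (Fin d)) → ℂ) ⊆ orderedRegion k d) :
    Integrable fun y => S y * F y := by
  refine F.integrable_mul_of_norm_le_one_add_infDist_inv_pow volume isOpen_orderedRegion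
    compl_orderedRegion_nonempty hS (C := max C 0) (N := N) (M := N) (fun x hx => ?_) hF
  have hr : 0 < infDist x (orderedRegion k d)ᶜ :=
    (isOpen_orderedRegion.isClosed_compl.notMem_iff_infDist_pos compl_orderedRegion_nonempty).1
      (fun h => h hx)
  have hm : 0 < minGap x := minGap_pos hx
  have h1 : (1 + (minGap x)⁻¹) ^ N ≤ (1 + (infDist x (orderedRegion k d)ᶜ)⁻¹) ^ N :=
    pow_le_pow_left₀ (by positivity) (add_le_add le_rfl (inv_anti₀ hr (infDist_compl_orderedRegion_le_minGap hx))) N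
  have h2 : 0 ≤ (1 + ‖x‖) ^ N * (1 + (minGap x)⁻¹) ^ N := by positivity
  calc ‖S x‖ ≤ C * (1 + ‖x‖) ^ N * (1 + (minGap x)⁻¹) ^ N := hb x hx
    _ = C * ((1 + ‖x‖) ^ N * (1 + (minGap x)⁻¹) ^ N) := by ring
    _ ≤ max C 0 * ((1 + ‖x‖) ^ N * (1 + (minGap x)⁻¹) ^ N) := mul_le_mul_of_nonneg_right (le_max_left _ _) h2
    _ ≤ max C 0 * ((1 + ‖x‖) ^ N * (1 + (infDist x (orderedRegion k d)ᶜ)⁻¹) ^ N) :=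
        mul_le_mul_of_nonneg_left (mul_le_mul_of_nonneg_left h1 (by positivity)) (le_max_right _ _)
    _ = max C 0 * (1 + ‖x‖) ^ N * (1 + (infDist x (orderedRegion k d)ᶜ)⁻¹) ^ N := by ring

/-! ### Translation invariance of densities -/

/-- The ordered region is invariant under diagonal translations. [folklore] -/
theorem add_const_mem_orderedRegion {x : Fin (k + 2) → EuclideanSpace ℝ (Fin d)}
    (hx : x ∈ orderedRegion k d) (a : EuclideanSpace ℝ (Fin d)) :
    (fun j => x j + a) ∈ orderedRegion k d := fun i => by
  simpa using hx i

/-- **A density of a translation-invariant distribution is translation invariant**: if `𝔖_{k+2}` is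
E1-covariant and `S`, continuous on `Ω`, represents it near every point of `Ω`, then
`S(x + a) = S(x)` for `x ∈ Ω` and every `a` (E1 for `F ↦ F(· − a)`, the translation invariance of
Lebesgue measure, and the uniqueness of continuous densities). [cite: OsterwalderSchraderCMP1975, §II (E1)] -/
theorem density_translate_eq (𝔖 : SchwingerFamily (EuclideanSpace ℝ (Fin d)))
    (hE1 : 𝔖.IsEuclideanCovariant) {S : (Fin (k + 2) → EuclideanSpace ℝ (Fin d)) → ℂ}
    (hS : ContinuousOn S (orderedRegion k d))
    (hloc : ∀ x ∈ orderedRegion k d, ∃ ρ : ℝ, 0 < ρ ∧ Metric.ball x ρ ⊆ orderedRegion k d ∧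
      ∀ F : 𝓢((Fin (k + 2) → EuclideanSpace ℝ (Fin d)), ℂ),
        tsupport (F : (Fin (k + 2) → EuclideanSpace ℝ (Fin d)) → ℂ) ⊆ Metric.ball x ρ →
          𝔖 (k + 2) F = ∫ y, S y * F y)
    (a : EuclideanSpace ℝ (Fin d)) {x : Fin (k + 2) → EuclideanSpace ℝ (Fin d)} (hx : x ∈ orderedRegion k d) :
    S (fun j => x j + a) = S x := by
  -- the translated density
  set S' : (Fin (k + 2) → EuclideanSpace ℝ (Fin d)) → ℂ := fun y => S (fun j => y j + a) with hS'
  have hτc : Continuous fun y : Fin (k + 2) → EuclideanSpace ℝ (Fin d) => fun j => y j + a :=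
    continuous_pi fun j => (continuous_apply j).add continuous_const
  have hS'c : ContinuousOn S' (orderedRegion k d) :=
    hS.comp hτc.continuousOn fun y hy => add_const_mem_orderedRegion hy a
  -- both represent `𝔖_{k+2}` on compactly supported test functions of `Ω`
  have hrepS : ∀ F : 𝓢((Fin (k + 2) → EuclideanSpace ℝ (Fin d)), ℂ),
      tsupport (F : (Fin (k + 2) → EuclideanSpace ℝ (Fin d)) → ℂ) ⊆ orderedRegion k d →
        HasCompactSupport (F : (Fin (k + 2) → EuclideanSpace ℝ (Fin d)) → ℂ) → 𝔖 (k + 2) F = ∫ y, S y * F y :=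
    fun F hF hFc => QuantumLattice.apply_eq_integral_of_localDensity_of_hasCompactSupport volume (𝔖 (k + 2))
      isOpen_orderedRegion hS hloc F hFc hF
  have hrepS' : ∀ F : 𝓢((Fin (k + 2) → EuclideanSpace ℝ (Fin d)), ℂ),
      tsupport (F : (Fin (k + 2) → EuclideanSpace ℝ (Fin d)) → ℂ) ⊆ orderedRegion k d →
        HasCompactSupport (F : (Fin (k + 2) → EuclideanSpace ℝ (Fin d)) → ℂ) → 𝔖 (k + 2) F = ∫ y, S' y * F y := by
    intro F hF hFc
    -- `G = F(· − a)` is supported in `Ω` (compactly) and `𝔖 G = 𝔖 F`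
    set c : Fin (k + 2) → EuclideanSpace ℝ (Fin d) := fun _ => a with hc
    set G := translateMulti a F with hG
    have hcomp : (G : (Fin (k + 2) → EuclideanSpace ℝ (Fin d)) → ℂ) =
        (F : _ → ℂ) ∘ (Homeomorph.subRight c) := by
      funext y
      rw [hG, translateMulti_apply]
      rfl
    have hGsupp : tsupport (G : (Fin (k + 2) → EuclideanSpace ℝ (Fin d)) → ℂ) ⊆ orderedRegion k d := by
      rw [hcomp, tsupport_comp_eq_preimage]
      intro y hy
      have h1 : (Homeomorph.subRight c) y ∈ orderedRegion k d := hF hy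
      have h1' : (fun j => y j - a) ∈ orderedRegion k d := h1
      have h2 := add_const_mem_orderedRegion h1' a
      simpa using h2
    have hGc : HasCompactSupport (G : (Fin (k + 2) → EuclideanSpace ℝ (Fin d)) → ℂ) := by
      rw [hcomp]; exact hFc.comp_homeomorph _
    calc 𝔖 (k + 2) F = 𝔖 (k + 2) G := (hE1.translateMulti (k + 2) a F).symm
      _ = ∫ y, S y * G y := hrepS G hGsupp hGc
      _ = ∫ y, (fun z => S (z + c) * F z) (y - c) := by
          refine integral_congr_ae (Eventually.of_forall fun y => ?_)
          simp only [sub_add_cancel]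
          rw [hG, translateMulti_apply]
          rfl
      _ = ∫ z, S (z + c) * F z := integral_sub_right_eq_self (fun z => S (z + c) * F z) c
      _ = ∫ y, S' y * F y := by
          refine integral_congr_ae (Eventually.of_forall fun y => ?_)
          simp only [hS']
          rfl
  -- uniqueness of continuous densities
  have heq := eqOn_of_forall_integral_mul_eq isOpen_orderedRegion hS'c hS fun F hF hFc => by
    rw [← hrepS' F hF hFc, hrepS F hF hFc]
  exact heq hx

/-! ### Theorem 4.1 with the global representation (4.4) -/

/-- **Osterwalder–Schrader II, Theorem 4.1 with (4.4) and (4.5), global form.** For a Schwinger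
family with E0' (linear growth), E1 and E2 and every `k`, the distribution `𝔖_{k+2}` has a density
`S` on the ordered region `Ω = {x⁰_0 < ⋯ < x⁰_{k+1}}` which is continuous, locally the restriction
to the real points of a holomorphic function, tempered —
`‖S x‖ ≤ C (1 + ‖x‖)ᴺ (1 + (minGap x)⁻¹)ᴺ` — invariant under diagonal translations, and such that
**`𝔖_{k+2}(F) = ∫ S F` for every `F ∈ 𝓢` with `tsupport F ⊆ Ω`**, the integrand being integrable
("such that for all `f ∈ 𝒮(ℝ₊^{4k})`, `S_k(f) = ∫ S_k(ζ) f(ζ) d^{4k}ζ` (4.4) and for some `α` and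
`β` and all `ζ` … (4.5)"). [cite: OsterwalderSchraderCMP1975, Thm. 4.1 (4.4)–(4.5)] -/
theorem schwinger_exists_density_global (𝔖 : SchwingerFamily (EuclideanSpace ℝ (Fin d)))
    (hE1 : 𝔖.IsEuclideanCovariant) (hE2 : 𝔖.IsOSReflectionPositive) (hE0 : 𝔖.HasLinearGrowth) :
    ∃ S : (Fin (k + 2) → EuclideanSpace ℝ (Fin d)) → ℂ, ContinuousOn S (orderedRegion k d) ∧
      (∀ x ∈ orderedRegion k d, ∃ ρ : ℝ, 0 < ρ ∧ Metric.ball x ρ ⊆ orderedRegion k d ∧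
        ∃ Sc : (Fin (k + 2) → Fin d → ℂ) → ℂ, DifferentiableOn ℂ Sc (ball (cfgPt x) ρ) ∧
          ∀ y ∈ Metric.ball x ρ, Sc (cfgPt y) = S y) ∧
      (∃ C : ℝ, ∃ N : ℕ, 0 ≤ C ∧ ∀ x ∈ orderedRegion k d,
        ‖S x‖ ≤ C * (1 + ‖x‖) ^ N * (1 + (minGap x)⁻¹) ^ N) ∧
      (∀ x ∈ orderedRegion k d, ∀ a : EuclideanSpace ℝ (Fin d), S (fun j => x j + a) = S x) ∧
      ∀ F : 𝓢((Fin (k + 2) → EuclideanSpace ℝ (Fin d)), ℂ),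
        tsupport (F : (Fin (k + 2) → EuclideanSpace ℝ (Fin d)) → ℂ) ⊆ orderedRegion k d →
          Integrable (fun y => S y * F y) ∧ 𝔖 (k + 2) F = ∫ y, S y * F y := by
  obtain ⟨S, hSc, hloc, C, N, hC, hb⟩ := schwinger_exists_realAnalytic_density_tempered (k := k) 𝔖 hE1 hE2 hE0
  have hloc' : ∀ x ∈ orderedRegion k d, ∃ ρ : ℝ, 0 < ρ ∧ Metric.ball x ρ ⊆ orderedRegion k d ∧
      ∀ F : 𝓢((Fin (k + 2) → EuclideanSpace ℝ (Fin d)), ℂ),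
        tsupport (F : (Fin (k + 2) → EuclideanSpace ℝ (Fin d)) → ℂ) ⊆ Metric.ball x ρ →
          𝔖 (k + 2) F = ∫ y, S y * F y := fun x hx => by
    obtain ⟨ρ, hρ, hρU, -, -, -, hrep⟩ := hloc x hx
    exact ⟨ρ, hρ, hρU, hrep⟩
  refine ⟨S, hSc, fun x hx => ?_, ⟨C, N, hC, hb⟩, fun x hx a => density_translate_eq 𝔖 hE1 hSc hloc' a hx,
    fun F hF => ?_⟩
  · obtain ⟨ρ, hρ, hρU, Sc, hSd, hScS, -⟩ := hloc x hx
    exact ⟨ρ, hρ, hρU, Sc, hSd, hScS⟩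
  · have hint := integrable_density_mul hSc hb F hF
    exact ⟨hint, QuantumLattice.apply_eq_integral_of_localDensity volume (𝔖 (k + 2)) isOpen_orderedRegion
      hSc hloc' F hF hint⟩

end Literature.MathematicalPhysics.QuantumFieldTheory
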